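import Summits.BirchSwinnertonDyer.Rank1Residual.X2.LocalInertiaTateQuotientBounds
import Summits.BirchSwinnertonDyer.Rank1Residual.X2.GreenbergVatsalTateDatumCofree
import Summits.BirchSwinnertonDyer.Rank1Residual.X11b.LocalTrivialityBridge
import Literature.NumberTheory.EllipticCurves.TateFormPrimePowerTorsionProofs
import Literature.NumberTheory.EllipticCurves.InertiaInvariantsMultiplicativeProofs
import Literature.NumberTheory.EllipticCurves.KodairaNeronUnramifiedInertiaProofs
import Literature.NumberTheory.EllipticCurves.PeriodIndexCorestrictionLocal
import Literature.NumberTheory.GaloisRepresentations.LocalReciprocityThetaProofs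
import Literature.NumberTheory.GaloisRepresentations.LocalGaloisGroupFrobeniusProofs
import Literature.NumberTheory.GaloisRepresentations.CyclotomicCharacterSurjectiveProofs
import HarnessLib

/-!
# `#H¹(I_v, E[p^∞])[p] ≤ p` at a MULTIPLICATIVE place `v ∤ p`, and the vanishing of
# Frobenius-stable `p`-torsion classes when `ℓ ≢ a_v (mod p)` (Greenberg–Vatsal §2 Prop. (2.4) at a
# multiplicative `ℓ ∈ Σ₀`, inertia side: `d_ℓ ≤ 1`, and `d_ℓ = 0` when `ℓ ≢ a_ℓ`) — cell
# `b2b-bsdres`, unit `b2b-bsdres-eisenstein-p2`, gen 30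

HONEST FRAMING (run/shared/lean/b2b/bsd-rank1-residual/, verbatim in every file): the goal of the
cell is to DELETE the COMBINATION-SHAPED residual classes of the Birch–Swinnerton-Dyer formula for
ALL analytic-rank `≤ 1` elliptic curves over `ℚ` — "full BSD formula for every rank `≤ 1` curve in
class `C`" assembled STRICTLY from published theorems — so that the rank-`≤ 1` remainder becomes
exactly the CONSTRUCTION-SHAPED classes, which are TYPED (missing-input `Prop`s), NOT attempted.
This is not "finishing BSD". Research route (programme P1 of X2-GAP §34 = the UPPER HALF of
Greenberg–Vatsal's Cor. (2.3)/Prop. (2.4) in the kernel); NO CLAIM BEYOND STATED CLASSES; nothing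
here changes a label. Theorems only; no definition, no named fact, no `sorry`.

WHAT. `E/K` elliptic over a number field, `p` a prime, `v ∤ p` a finite place of MULTIPLICATIVE
reduction, and a Tate parametrisation `Ψ : K̄_v^* → E(K̄_v)` (surjective, kernel `q^ℤ`,
`0 < |q|_v < 1`) with the TWISTED equivariance `σ•Ψ(u) = χ(σ)Ψ(σu)`, `χ(σ) = [σt = t] − [σt ≠ t]`,
`t = √γ(E)` — the shape of the tree's named fact `Silverman1994_thmV53_corV54_tateUniformisation`
(Silverman *ATAEC* V.5.2–5.4), taken as explicit DATA here — such that the local inertia group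
fixes `t` (`ht`: `K_v(t)/K_v` unramified, automatic in the split case). The gen-9 Tate datum
`C = ι⁻¹Ψ(μ) ⊂ A = E[p^∞]` (`GreenbergVatsalTateDatum.tateDatum`) then satisfies EVERY hypothesis
of the abstract gen-29 files `LocalInertiaTateQuotient{,Bounds}` for the local representation
`ρ = E[p^∞]|_{Γ_{K_v}}` (§1: `Γ_{K_v}`-stability, `I_v` trivial on `C` and on `A/C`, `C` and `A`
`p`-divisible, `A` `p`-primary, `#C[p] = p`, `#(A/C)[p] = p`, and `I_v` does NOT act trivially on
`A` — Silverman VII.7.1 via the tree's `TateFormPrimePowerTorsionProofs`), whence, for any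
`H ≤ Γ_K` containing the global inertia group `I_v` (e.g. `H = Gal(K̄/K_∞)`):

* §2 **`card_le_of_prime_nsmul_eq_zero` / `natCard_torsionBy_discreteH1_inertiaIn_le`**:
  `#H¹(H ∩ I_v, E[p^∞])[p] ≤ p` (and this `p`-torsion is finite) — the bound `d_v ≤ 1` per place
  `η ∣ v` of `K_∞` in GV's "`corank 𝓗_ℓ(ℚ_∞) = s_ℓ d_ℓ`";
* §3 **`resH1Hom_inertiaIn_eq_zero_of_prime_nsmul_eq_zero`**: if moreover `H` contains (the
  restriction of) every element of `Γ_{K_v}` killed by all continuous `Γ_{K_v} → ℤ_p` (e.g.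
  `H = ker κ` for a `ℤ_p`-extension `κ`), `p` is odd and `p ∤ q_v − χ(φ)` for an arithmetic
  Frobenius `φ` (`χ(φ) = ±1` the sign of `φ` on `t`, i.e. `a_v`), then every class
  `c ∈ H¹(H, E[p^∞])` whose restriction to `H ∩ I_v` is `p`-torsion restricts to ZERO there — the
  case `d_v = 0` ("`ℓ ≢ a_ℓ (mod p)`"); `…_kerSubgroup` is the `H = ker κ` spelling.

Method: inflation along the surjection `absInertia K_v ↠ H ∩ I_v` is injective on `H¹`
(`ContinuousH1TrivialAction.map_one_injective_of_surjective`), which transports the abstract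
statements `natCard_torsionBy_H1_absInertia_le` / `oneCocycleClass_eq_zero_of_conj`; the element
`g` of §3 is the prime-to-`p` part of `φ` (`FrobeniusPrimeToPPart`), which lies in `H` and acts on
`A/C` by `χ(g) = χ(φ)` (`p` odd).

References: [GreenbergVatsal2000] §2 pp. 14–15, Prop. (2.4) pp. 22–23; [Greenberg1989] §2 Prop. 2;
[SilvermanATAEC1994] V.3.1, V.5.2–5.4; [SilvermanAEC2009] VII.7.1; HOME X2-GAP.md §34.6.
-/

set_option autoImplicit false

noncomputable section

open scoped Classical NNReal AddSubgroup

open CategoryTheory Function Filter NumberField IsDedekindDomain Field ValuativeRel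
open Literature.NumberTheory.EllipticCurves Literature.NumberTheory.EllipticCurves.GreenbergSelmer
  Literature.NumberTheory.GaloisRepresentations
  Literature.NumberTheory.GaloisRepresentations.IsNonarchimedeanLocalField
  IsDedekindDomain.HeightOneSpectrum
  Summit.BirchSwinnertonDyer.Rank1Residual.X11b.LocBridge
  Summit.BirchSwinnertonDyer.Rank1Residual.X2.GreenbergVatsalTateDatum
  Summit.BirchSwinnertonDyer.Rank1Residual.X2.GreenbergVatsalTateDatumSign
  Summit.BirchSwinnertonDyer.Rank1Residual.X2.GreenbergVatsalTateDatumCofree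
  Summit.BirchSwinnertonDyer.Rank1Residual.X2.LocalInertiaTateQuotient

universe u

namespace Summit.BirchSwinnertonDyer.Rank1Residual.X2.LocalInertiaCohomologyMultiplicative

variable {K : Type u} [Field K] [NumberField K] (W : WeierstrassCurve K) (p : ℕ) [hp : Fact p.Prime]
  {v : HeightOneSpectrum (𝓞 K)}
  (Ψ : Additive (AlgebraicClosure (v.adicCompletion K))ˣ →+ localPoints W (v.adicCompletion K))
  (t : AlgebraicClosure (v.adicCompletion K))
  (hΨσ : ∀ (σ : absoluteGaloisGroup (v.adicCompletion K))
      (u : (AlgebraicClosure (v.adicCompletion K))ˣ),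
    σ • Ψ (Additive.ofMul u) =
      (if Field.absoluteGaloisGroup.toAlgEquiv (v.adicCompletion K) σ t = t then (1 : ℤ)
        else -1) •
      Ψ (Additive.ofMul (Units.map
        (Field.absoluteGaloisGroup.toAlgEquiv (v.adicCompletion K) σ :
          AlgebraicClosure (v.adicCompletion K) →* AlgebraicClosure (v.adicCompletion K)) u)))
  (hsurj : Function.Surjective Ψ) {q : v.adicCompletion K} (hq0 : q ≠ 0) (hq1 : Valued.v q < 1)
  (hker : ∀ u : (AlgebraicClosure (v.adicCompletion K))ˣ, Ψ (Additive.ofMul u) = 0 →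
    ∃ a : ℤ, (u : AlgebraicClosure (v.adicCompletion K)) =
      algebraMap (v.adicCompletion K) (AlgebraicClosure (v.adicCompletion K)) q ^ a)
  (ht : ∀ σ ∈ absInertia (v.adicCompletion K),
    Field.absoluteGaloisGroup.toAlgEquiv (v.adicCompletion K) σ t = t)
  (hpv : ((p : ℕ) : 𝓞 K) ∉ v.asIdeal)

/-! ## §1. The Tate datum satisfies the hypotheses of `LocalInertiaTateQuotient` -/

omit hp in
/-- The local representation `ρ = E[p^∞]|_{Γ_{K_v}}` acts through `absGaloisRestrict`
(definitional). [folklore] -/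
theorem restrict_primaryGaloisModule_apply (σ : absoluteGaloisGroup (v.adicCompletion K))
    (m : W.geomPrimaryTorsion p) :
    (primaryGaloisModule W p).restrict (absGaloisRestrict K (v.adicCompletion K)) σ m =
      absGaloisRestrict K (v.adicCompletion K) σ • m :=
  rfl

include hΨσ ht in
/-- Under `ht` the parametrisation is EQUIVARIANT on the inertia group (`χ(σ) = 1` for `σ ∈ I_v`).
[cite: SilvermanATAEC1994, Ch. V Lemma 5.2 (c), Thm. 5.3, Cor. 5.4] -/
theorem equivariant_of_mem_absInertia :
    ∀ σ ∈ absInertia (v.adicCompletion K), ∀ u : (AlgebraicClosure (v.adicCompletion K))ˣ,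
      σ • Ψ (Additive.ofMul u) = Ψ (Additive.ofMul (Units.map
        (Field.absoluteGaloisGroup.toAlgEquiv (v.adicCompletion K) σ :
          AlgebraicClosure (v.adicCompletion K) →* AlgebraicClosure (v.adicCompletion K)) u)) := by
  intro σ hσ u
  rw [hΨσ σ u, if_pos (ht σ hσ), one_zsmul]

omit hp in
/-- The Tate datum `C` is `Γ_{K_v}`-stable (as a `ℤ`-submodule, for the abstract files).
[cite: GreenbergVatsal2000, §2 pp. 14–15] -/
theorem plus_le_comap (g : absoluteGaloisGroup (v.adicCompletion K)) :
    AddSubgroup.toIntSubmodule (tateDatum W p Ψ (sign_disj W Ψ t hΨσ)).plus ≤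
      (AddSubgroup.toIntSubmodule (tateDatum W p Ψ (sign_disj W Ψ t hΨσ)).plus).comap
        ((primaryGaloisModule W p).restrict (absGaloisRestrict K (v.adicCompletion K)) g) := by
  intro m hm
  rw [Submodule.mem_comap]
  exact (tateDatum W p Ψ (sign_disj W Ψ t hΨσ)).smul_mem g hm

include hpv in
/-- `p^k` is prime to the residue characteristic of `K_v` (`v ∤ p`). [folklore] -/
theorem pow_coprime_ringChar (k : ℕ) : (p ^ k).Coprime (ringChar 𝓀[v.adicCompletion K]) := by
  have hℓ : (ringChar 𝓀[v.adicCompletion K]).Prime :=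
    ringChar_residueField_prime (F := v.adicCompletion K)
  refine Nat.Coprime.pow_left k ((Nat.coprime_primes hp.out hℓ).2 fun h ↦ ?_)
  exact not_ringChar_residueField_adicCompletion_dvd (w := v) hpv (by rw [← h])

include hq0 hq1 hker hΨσ ht hpv in
/-- **The inertia group acts TRIVIALLY on the Tate datum `C`** at `v ∤ p`: a point of `C` is
`Ψ(ζ)` for a root of unity `ζ` of `p`-power order (`Ψ(ζ^{p^k}) = 0` forces `ζ^{p^k} = 1`, `Ψ`
being injective on roots of unity), which the inertia group fixes (`p ≠` residue characteristic,
`smul_eq_self_of_mem_absInertia_of_pow_eq_one`); and `Ψ` is equivariant on inertia. GV p. 14: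
`C ≅ μ_{p^∞}` is unramified away from `p`. [cite: GreenbergVatsal2000, §2 pp. 14–15]
[cite: SilvermanATAEC1994, Ch. V Thm. 3.1 (c),(d)] -/
theorem smul_eq_self_of_mem_absInertia_of_mem_plus {σ : absoluteGaloisGroup (v.adicCompletion K)}
    (hσ : σ ∈ absInertia (v.adicCompletion K)) {c : W.geomPrimaryTorsion p}
    (hc : c ∈ (tateDatum W p Ψ (sign_disj W Ψ t hΨσ)).plus) :
    absGaloisRestrict K (v.adicCompletion K) σ • c = c := by
  obtain ⟨ζ, hζfin, hζc⟩ := (mem_tateDatum_plus_iff _ c).1 hc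
  obtain ⟨k, hk⟩ := (AddCommGroup.mem_primaryComponent).1 c.2
  -- `ζ^{p^k} = 1`
  have h0 : Ψ (Additive.ofMul (ζ ^ p ^ k)) = 0 := by
    rw [ofMul_pow, map_nsmul, hζc, ← map_nsmul, ← AddSubmonoidClass.coe_nsmul]
    have : p ^ k • c = 0 := Subtype.ext (by rw [AddSubmonoidClass.coe_nsmul, ZeroMemClass.coe_zero]; exact hk)
    rw [this, ZeroMemClass.coe_zero, map_zero]
  have hζpk : ζ ^ p ^ k = 1 :=
    GreenbergVatsalTateKummerLocal.eq_one_of_isOfFinOrder_of_map_eq_zero W Ψ hker hq0 hq1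
      (hζfin.pow) h0
  -- inertia fixes `ζ`
  have hfix : σ • (ζ : AlgebraicClosure (v.adicCompletion K)) = ζ := by
    have hcop := pow_coprime_ringChar p hpv k
    refine smul_eq_self_of_mem_absInertia_of_pow_eq_one (F := v.adicCompletion K) (m := p ^ k)
      ?_ (pow_ne_zero k hp.out.ne_zero) hσ ?_
    · intro hdvd
      have hℓ : (ringChar 𝓀[v.adicCompletion K]).Prime :=
        ringChar_residueField_prime (F := v.adicCompletion K)
      exact hℓ.one_lt.ne' (hcop.symm.eq_one_of_dvd hdvd)
    · rw [← Units.val_pow_eq_pow_val, hζpk, Units.val_one]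
  have hmapζ : Units.map (Field.absoluteGaloisGroup.toAlgEquiv (v.adicCompletion K) σ :
      AlgebraicClosure (v.adicCompletion K) →* AlgebraicClosure (v.adicCompletion K)) ζ = ζ := by
    ext
    rw [Units.coe_map, MonoidHom.coe_coe, ← Field.absoluteGaloisGroup.smul_def, hfix]
  apply pointsMap_coe_injective W p
  change pointsMap W (v.adicCompletion K)
      (((absGaloisRestrict K (v.adicCompletion K) σ • c : W.geomPrimaryTorsion p)) : W.geomPoints) =
    pointsMap W (v.adicCompletion K) (c : W.geomPoints)
  rw [primaryComponent.coe_smul, GreenbergVatsalReductionDatum.pointsMap_absGaloisRestrict_smul,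
    ← hζc, equivariant_of_mem_absInertia W Ψ t hΨσ ht σ hσ ζ, hmapζ]

include hsurj hker ht in
/-- **`I_v` acts trivially on `D = A/C`** (gen 9 `tateDatum_htriv`, in the `absInertia` spelling).
[cite: GreenbergVatsal2000, §2 pp. 14–15] -/
theorem smul_sub_mem_plus_of_mem_absInertia {σ : absoluteGaloisGroup (v.adicCompletion K)}
    (hσ : σ ∈ absInertia (v.adicCompletion K)) (m : W.geomPrimaryTorsion p) :
    absGaloisRestrict K (v.adicCompletion K) σ • m - m ∈
      (tateDatum W p Ψ (sign_disj W Ψ t hΨσ)).plus :=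
  tateDatum_htriv W p Ψ (sign_disj W Ψ t hΨσ) hsurj hker
    (equivariant_of_mem_absInertia W Ψ t hΨσ ht) _ (Subgroup.mem_map_of_mem _ hσ) m

omit [NumberField K] hp in
/-- `E[p^∞]` is `p`-primary (as a statement about the subtype). [cite: SilvermanAEC2009, Prop. III.4.2(a)] -/
theorem primary_curve (a : W.geomPrimaryTorsion p) : ∃ n : ℕ, p ^ n • a = 0 := by
  obtain ⟨n, hn⟩ := (AddCommGroup.mem_primaryComponent).1 a.2
  exact ⟨n, Subtype.ext (by rw [AddSubmonoidClass.coe_nsmul, ZeroMemClass.coe_zero]; exact hn)⟩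

variable [W.IsElliptic]

omit [NumberField K] in
/-- `E[p^∞][p]` is finite (it is `E[p]`). [cite: SilvermanAEC2009, Cor. III.6.4(b)] -/
theorem finite_torsionBy_curve :
    Finite (Submodule.torsionBy ℤ (W.geomPrimaryTorsion p) (p : ℤ)) := by
  have hinj' : Function.Injective (fun a : Submodule.torsionBy ℤ (W.geomPrimaryTorsion p) (p : ℤ) ↦
      (⟨((a : W.geomPrimaryTorsion p) : W.geomPoints), (W.mem_geomTorsion_iff (p : ℤ) _).2 (by
        have := (Submodule.mem_torsionBy_iff _ _).1 a.2
        rw [← AddSubgroupClass.coe_zsmul, this, ZeroMemClass.coe_zero])⟩ :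
        W.geomTorsion (p : ℤ))) := by
    intro a b hab
    exact Subtype.ext (Subtype.ext (congrArg (fun x : W.geomTorsion (p : ℤ) ↦ (x : W.geomPoints)) hab))
  haveI : Finite (W.geomTorsion (p : ℤ)) :=
    WeierstrassCurve.finite_torsionPoints_holds W (AlgebraicClosure K)
      (Int.natCast_ne_zero.mpr hp.out.ne_zero)
  exact Finite.of_injective _ hinj'

/-- `#E[p^∞][p] = p²`. [cite: SilvermanAEC2009, Cor. III.6.4(b)] -/
theorem natCard_torsionBy_curve :
    Nat.card (Submodule.torsionBy ℤ (W.geomPrimaryTorsion p) (p : ℤ)) = p ^ 2 := by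
  haveI : CharZero K := charZero_of_injective_algebraMap (algebraMap ℚ K).injective
  have hn : ((p : ℕ) : ℤ) ≠ 0 := by exact_mod_cast hp.out.ne_zero
  have e : Submodule.torsionBy ℤ (W.geomPrimaryTorsion p) (p : ℤ) ≃ W.geomTorsion (p : ℤ) :=
    { toFun := fun x ↦ ⟨((x : W.geomPrimaryTorsion p) : W.geomPoints), by
        rw [W.mem_geomTorsion_iff]
        have h := (Submodule.mem_torsionBy_iff _ _).1 x.2
        rw [← AddSubgroupClass.coe_zsmul, h, ZeroMemClass.coe_zero]⟩
      invFun := fun P ↦ ⟨⟨(P : W.geomPoints), by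
          rw [WeierstrassCurve.geomPrimaryTorsion, AddCommGroup.mem_primaryComponent]
          refine ⟨1, ?_⟩
          have h := (W.mem_geomTorsion_iff (p : ℤ) _).mp P.2
          rwa [pow_one, ← natCast_zsmul]⟩, by
        rw [Submodule.mem_torsionBy_iff]
        apply Subtype.ext
        rw [AddSubgroupClass.coe_zsmul, ZeroMemClass.coe_zero]
        exact (W.mem_geomTorsion_iff (p : ℤ) _).mp P.2⟩
      left_inv := fun x ↦ by ext; rfl
      right_inv := fun P ↦ by ext; rfl }
  rw [Nat.card_congr e, W.natCard_geomTorsion (p : ℤ) hn]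
  simp

include hq0 hq1 hker in
/-- `#C[p] = p` for the Tate datum, in the `Submodule.torsionBy ℤ ↥C` spelling of the abstract files
(`natCard_tateDatum_plus_inf_torsionBy`). [cite: GreenbergVatsal2000, §2 pp. 14, 16] -/
theorem natCard_torsionBy_plus :
    Nat.card (Submodule.torsionBy ℤ
      (AddSubgroup.toIntSubmodule (tateDatum W p Ψ (sign_disj W Ψ t hΨσ)).plus) (p : ℤ)) = p := by
  have e : Submodule.torsionBy ℤ
      (AddSubgroup.toIntSubmodule (tateDatum W p Ψ (sign_disj W Ψ t hΨσ)).plus) (p : ℤ) ≃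
      ↥((tateDatum W p Ψ (sign_disj W Ψ t hΨσ)).plus ⊓ (↥(W.geomPrimaryTorsion p))[(p : ℤ)]) :=
    { toFun := fun c ↦ ⟨((c : AddSubgroup.toIntSubmodule (tateDatum W p Ψ (sign_disj W Ψ t hΨσ)).plus) :
          W.geomPrimaryTorsion p), AddSubgroup.mem_inf.2 ⟨
            show ((c : AddSubgroup.toIntSubmodule (tateDatum W p Ψ (sign_disj W Ψ t hΨσ)).plus) :
              W.geomPrimaryTorsion p) ∈ (tateDatum W p Ψ (sign_disj W Ψ t hΨσ)).plus from
              (c : AddSubgroup.toIntSubmodule (tateDatum W p Ψ (sign_disj W Ψ t hΨσ)).plus).2, by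
            rw [AddSubgroup.torsionBy.nsmul_iff]
            have h := (Submodule.mem_torsionBy_iff _ _).1 c.2
            rw [Nat.cast_smul_eq_nsmul] at h
            rw [← Submodule.coe_smul_of_tower, h, Submodule.coe_zero]⟩⟩
      invFun := fun c ↦ ⟨⟨(c : W.geomPrimaryTorsion p), (AddSubgroup.mem_inf.1 c.2).1⟩, by
          have h := AddSubgroup.torsionBy.nsmul_iff.1 (AddSubgroup.mem_inf.1 c.2).2
          rw [Submodule.mem_torsionBy_iff, Nat.cast_smul_eq_nsmul]
          exact Subtype.ext (by rw [Submodule.coe_smul_of_tower, Submodule.coe_zero]; exact h)⟩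
      left_inv := fun c ↦ Subtype.ext (Subtype.ext rfl)
      right_inv := fun c ↦ Subtype.ext rfl }
  rw [Nat.card_congr e]
  exact natCard_tateDatum_plus_inf_torsionBy W p Ψ (sign_disj W Ψ t hΨσ) hq0 hq1 hker

include hq0 hq1 hker in
/-- `#(A/C)[p] = p` for the Tate datum (`#A[p] = p² = #C[p]·#(A/C)[p]`, `C` divisible): the
unramified quotient `D ≅ ℚ_p/ℤ_p(χ)` is a LINE. [cite: GreenbergVatsal2000, §2 pp. 14–15] -/
theorem natCard_torsionBy_quotient_plus :
    Nat.card (Submodule.torsionBy ℤ (W.geomPrimaryTorsion p ⧸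
      AddSubgroup.toIntSubmodule (tateDatum W p Ψ (sign_disj W Ψ t hΨσ)).plus) (p : ℤ)) = p := by
  have h := natCard_torsionBy_eq_mul (A := W.geomPrimaryTorsion p)
    (AddSubgroup.toIntSubmodule (tateDatum W p Ψ (sign_disj W Ψ t hΨσ)).plus) p
    (tateDatum_plus_divisible W p Ψ (sign_disj W Ψ t hΨσ))
  rw [natCard_torsionBy_curve, natCard_torsionBy_plus W p Ψ t hΨσ hq0 hq1 hker, sq] at h
  exact (Nat.eq_of_mul_eq_mul_left hp.out.pos h).symm

include hq0 hq1 hker in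
/-- `(A/C)[p]` is finite for the Tate datum. [cite: GreenbergVatsal2000, §2 pp. 14–15] -/
theorem finite_torsionBy_quotient_plus :
    Finite (Submodule.torsionBy ℤ (W.geomPrimaryTorsion p ⧸
      AddSubgroup.toIntSubmodule (tateDatum W p Ψ (sign_disj W Ψ t hΨσ)).plus) (p : ℤ)) := by
  apply Nat.finite_of_card_ne_zero
  rw [natCard_torsionBy_quotient_plus W p Ψ t hΨσ hq0 hq1 hker]
  exact hp.out.ne_zero

include hpv in
/-- **The inertia group does NOT act trivially on `E[p^∞]` at a multiplicative `v ∤ p`**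
(Silverman *AEC* VII.7.1, multiplicative case: `|j|_v > 1` forces ramified `p`-power torsion;
tree `exists_not_forall_inertia_smul_eq_prime_pow_of_one_lt_j`), in the `absInertia` spelling.
[cite: SilvermanAEC2009, Thm. VII.7.1 (proof, multiplicative case) with Prop. VII.5.5 and Cor. III.6.4(b)] -/
theorem exists_mem_absInertia_smul_ne (hmult : W.HasMultiplicativeReductionAt v) :
    ∃ σ ∈ absInertia (v.adicCompletion K), ∃ a : W.geomPrimaryTorsion p,
      absGaloisRestrict K (v.adicCompletion K) σ • a ≠ a := by
  obtain ⟨w, hw⟩ := v.exists_spectralValuation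
  obtain ⟨𝔐, h𝔐⟩ := v.localPrimesAbove_nonempty
  have hj := W.one_lt_spectralValuation_j_of_hasMultiplicativeReductionAt hw hmult
  obtain ⟨k, hk⟩ := W.exists_not_forall_inertia_smul_eq_prime_pow_of_one_lt_j hw h𝔐 hj hp.out hpv
  push Not at hk
  obtain ⟨σ, hσ, P, hP, hne⟩ := hk
  rw [inertia_eq_absInertia hw h𝔐] at hσ
  obtain ⟨m, hm⟩ := exists_primaryTorsion_pointsMap_eq W p P k hP
  refine ⟨σ, hσ, m, fun heq ↦ hne ?_⟩
  rw [← hm, ← GreenbergVatsalReductionDatum.pointsMap_absGaloisRestrict_smul,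
    ← primaryComponent.coe_smul, heq]

/-! ## §2. `#H¹(H ∩ I_v, E[p^∞])[p] ≤ p` -/

section Bound

variable (H : Subgroup (absoluteGaloisGroup K))


include Ψ t hΨσ hsurj hq0 hq1 hker ht hpv in
/-- **`#H¹(H ∩ I_v, E[p^∞])[p] ≤ p` at a multiplicative `v ∤ p`** (for any `H ≤ Γ_K` containing
`I_v`), in the robust form: a finite set of classes killed by `p` has at most `p` elements. Proof:
inflation to `H¹(absInertia K_v, E[p^∞])` is injective (`map_one_injective_of_surjective`), and
there `#H¹[p] ≤ #(A/C)[p] = p` by the abstract `natCard_torsionBy_H1_absInertia_le` applied to the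
Tate datum (§1). This is `d_v ≤ 1` per place of `K_∞` above `v` in GV's Prop. (2.4).
[cite: GreenbergVatsal2000, §2 Prop. (2.4) pp. 22–23] [cite: Greenberg1989, §2 Prop. 2] -/
theorem card_le_of_prime_nsmul_eq_zero (hmult : W.HasMultiplicativeReductionAt v)
    (hIH : inertia v ≤ H)
    (s : Finset (discreteH1 (inertiaIn H v) (W.geomPrimaryTorsion p)))
    (hs : ∀ x ∈ s, p • x = 0) : s.card ≤ p := by
  haveI : CompactSpace (absoluteGaloisGroup (v.adicCompletion K)) :=
    absoluteGaloisGroup_compactSpace (v.adicCompletion K)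
  -- the surjection `θ : absInertia K_v ↠ H ∩ I_v` and the injectivity of inflation along it
  let θ : absInertia (v.adicCompletion K) →ₜ* inertiaIn H v :=
    { toFun := fun σ ↦ ⟨⟨absGaloisRestrict K (v.adicCompletion K) σ, ⟨σ, rfl⟩⟩,
        (mem_inertiaIn_iff H v _).2
          ⟨hIH (Subgroup.mem_map_of_mem _ σ.2), Subgroup.mem_map_of_mem _ σ.2⟩⟩
      map_one' := Subtype.ext (Subtype.ext (by simp))
      map_mul' := fun x y ↦ Subtype.ext (Subtype.ext (by simp))
      continuous_toFun := by
        refine Continuous.subtype_mk (Continuous.subtype_mk ?_ _) _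
        exact (absGaloisRestrict K (v.adicCompletion K)).continuous_toFun.comp continuous_subtype_val }
  have hθ : Function.Surjective θ := by
    intro x
    obtain ⟨σ, hσ, hσx⟩ := Subgroup.mem_map.1 ((mem_inertiaIn_iff H v x.1).1 x.2).2
    exact ⟨⟨σ, hσ⟩, Subtype.ext (Subtype.ext hσx)⟩
  set ρ : ContinuousRep (absoluteGaloisGroup (v.adicCompletion K)) ℤ (W.geomPrimaryTorsion p) :=
    (primaryGaloisModule W p).restrict (absGaloisRestrict K (v.adicCompletion K)) with hρ
  set C : Submodule ℤ (W.geomPrimaryTorsion p) :=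
    AddSubgroup.toIntSubmodule (tateDatum W p Ψ (sign_disj W Ψ t hΨσ)).plus with hCdef
  have hinj := map_one_injective_of_surjective
    (discreteTopRep (inertiaIn H v) (W.geomPrimaryTorsion p)) θ hθ
  have hpF : p.Coprime (ringChar 𝓀[v.adicCompletion K]) := by
    have h := pow_coprime_ringChar p hpv 1; rwa [pow_one] at h
  -- `H¹(absInertia K_v, res_θ A)` IS `H¹(absInertia K_v, ρ|)` (definitionally); its `p`-torsion `TI`
  set TI := Submodule.torsionBy ℤ (continuousCohomology 1
    (TopRep.res (θ : absInertia (v.adicCompletion K) →* inertiaIn H v)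
      (discreteTopRep (inertiaIn H v) (W.geomPrimaryTorsion p)))) (p : ℤ) with hTI
  -- the abstract bound `#TI ≤ #(A/C)[p] = p` and the finiteness of `TI`
  haveI := finite_torsionBy_curve W p
  haveI := finite_torsionBy_quotient_plus W p Ψ t hΨσ hq0 hq1 hker
  have hbound : Nat.card TI ≤ p := by
    have h := natCard_torsionBy_H1_absInertia_le (v.adicCompletion K) ρ C
      (plus_le_comap W p Ψ t hΨσ) hpF
      (fun σ hσ c hc ↦ smul_eq_self_of_mem_absInertia_of_mem_plus W p Ψ t hΨσ hq0 hq1 hker ht hpv hσ hc)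
      (fun σ hσ a ↦ smul_sub_mem_plus_of_mem_absInertia W p Ψ t hΨσ hsurj hker ht hσ a)
      (tateDatum_plus_divisible W p Ψ (sign_disj W Ψ t hΨσ))
      (GreenbergVatsalTorsionCurve.divisible_curve W p) (primary_curve W p)
      (natCard_torsionBy_plus W p Ψ t hΨσ hq0 hq1 hker).le (exists_mem_absInertia_smul_ne W p hpv hmult)
    rw [natCard_torsionBy_quotient_plus W p Ψ t hΨσ hq0 hq1 hker] at h
    exact h
  haveI hTIfin : Finite TI :=
    finite_torsionBy_continuousCohomology_one_absInertia (v.adicCompletion K) ρ hpF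
      (GreenbergVatsalTorsionCurve.divisible_curve W p)
  haveI : Fintype TI := Fintype.ofFinite TI
  -- the image of `s` under the (injective) inflation lies in `TI`
  have hjs : ∀ x ∈ s, ContinuousCohomology.map θ (𝟙 _) 1 x ∈ TI := by
    intro x hx
    rw [hTI, Submodule.mem_torsionBy_iff, Nat.cast_smul_eq_nsmul, ← map_nsmul, hs x hx, map_zero]
  calc s.card = (s.image (ContinuousCohomology.map θ (𝟙 _) 1)).card :=
        (Finset.card_image_of_injective s hinj).symm
    _ = ((s.image (ContinuousCohomology.map θ (𝟙 _) 1)).subtype (· ∈ TI)).card := by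
        rw [Finset.card_subtype, Finset.filter_true_of_mem]
        intro y hy
        obtain ⟨x, hx, rfl⟩ := Finset.mem_image.1 hy
        exact hjs x hx
    _ ≤ Fintype.card TI := Finset.card_le_univ _
    _ = Nat.card TI := Nat.card_eq_fintype_card.symm
    _ ≤ p := hbound

end Bound

end Summit.BirchSwinnertonDyer.Rank1Residual.X2.LocalInertiaCohomologyMultiplicative

end
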